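/-
Copyright (c) 2026. All rights reserved.
Released under Apache 2.0 license as described in the file LICENSE.
Authors: abc-iut cell, statement-typer seat abc-iut-L4-t9 (wave 2, block W2-B2), discharge.
-/
import Literature.AnabelianGeometry.AbsoluteAnabelian.AbsTopIII.BiAnabelianIncompatibility
import Literature.AnabelianGeometry.AbsoluteAnabelian.AugmentedCores

/-!
# [AbsTopIII] Corollary 3.7 (iii), proof, part 1: the boundary set `E_log` of `𝔖†_log` on `𝒟†_{≤3}`
# and its generation by the printed pairs

S. Mochizuki, *Topics in absolute anabelian geometry III* [MochizukiAbsTopIII2015] (manuscript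
`paper:url-5493eb38cbb7`; journal pagination not held), Cor 3.7 (iii) p. 88; proof p. 88: "The
proofs of the various assertions of the present Corollary 3.7 are entirely similar to the proofs of
the corresponding assertions of Corollary 3.6", i.e. here to the proof of Cor 3.6 (iii) p. 81:
"Write `E_log` for the set of ordered pairs of paths on `Γ⃗_{𝒟_{≤3}}` [i.e., the underlying oriented
graph of `𝒟_{≤3}`] consisting of pairs of paths of the following three types: (1)
`([λ^×]∘[id_⋎]∘[log]∘[γ], [λ^{×pf}]∘[id_{⋎+1}]∘[γ])`, where `[γ]` is a path on `𝒟_{≤3}` whose terminal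
vertex lies in the first row of `𝒟_{≤3}`; (2) `([λ^×]∘[γ], [λ^{×pf}]∘[γ])`, where `[γ]` is a path on
`𝒟_{≤3}` whose terminal vertex lies in the second row of `𝒟_{≤3}`; (3) `([γ], [γ])`, where `[γ]` is a
path on `𝒟_{≤3}` whose terminal vertex lies in the third row of `𝒟_{≤3}`. Then one verifies
immediately that `E_log` satisfies the conditions (a), (b), (c), (d), (e) given in §0 for a saturated
set." — read for the diagram `𝒟†_{≤3}` of Cor 3.7 (`pr_⋎ : 𝒳 ×_𝔈 𝒳 → 𝒳` in the role of `id_⋎`;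
presentation `BiAnabelianSetting.logObsDiagram` of `BiAnabelianIncompatibility.lean`, abc-iut-L4-t9;
rows 1/2/3 of `𝒟†_{≤3}` = the vertices `⋎`, `□`, `𝒩`).

This file (pure path combinatorics on the oriented graph `Γ⃗_{𝒟†_{≤3}}`; no functors): a pair of
`E_log` is presented as a CELL (`ObsCell`: type (3) `refl`, type (2) `times`, type (1) `log`, each
with its prefix `γ`) with its two sides `left`/`right`; the boundary set `ObsRel` = "being the two
sides of a cell"; a pair determines its cell (`ObsCell.ext'`); no two non-reflexive cells compose
(`ObsCell.dichotomy`); `E_log` IS SATURATED (`isSaturated_obsRel`) and EQUALS THE SATURATION of the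
printed generating pairs `LogGen` of the typed statement (`obsRel_iff_saturation`).  Reading note: the
typed statement `ObservableLogStmt` asks for the family GENERATED by the type-(1)/(2) pairs
(Def 3.5 (ii)); its boundary set consists of the printed pairs (1), (2), (3) with, in (3), `[γ]` of
POSITIVE length (every such path ends with `λ^×` or `λ^{×pf}`) — the length-zero path at `𝒩`, were it
admitted in (3), would contribute one further isolated reflexive pair; `ObsCell.refl` is accordingly
indexed by a path to `□` and a last edge.  Part 2 (`BiAnabelianObservableProofs.lean`) attaches the
homotopies and proves `ObservableLogStmt`.  Nothing here bears on [IUTchIII] Cor. 3.12.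
-/

set_option autoImplicit false

namespace Literature.AnabelianGeometry.AbsoluteAnabelian.AbsTopIII

open CategoryTheory Quiver DiagramOfCategories

universe u

namespace BiAnabelianSetting

/-! ## Small path lemmas on `Γ⃗_{𝒟†_{≤3}}` -/

section PathLemmas

/-- Prefixes of equal one-edge extensions agree. [folklore] -/
private theorem prefix_eq {V : Type*} [Quiver V] {a b c : V} {p p' : Path a b} {e e' : b ⟶ c}
    (h : p.cons e = p'.cons e') : p = p' :=
  eq_of_heq (Path.heq_of_cons_eq_cons h)

/-- Last edges of equal one-edge extensions agree. [folklore] -/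
private theorem edge_eq {V : Type*} [Quiver V] {a b c : V} {p p' : Path a b} {e e' : b ⟶ c}
    (h : p.cons e = p'.cons e') : e = e' :=
  eq_of_heq (Path.hom_heq_of_cons_eq_cons h)

/-- The two observation edges `λ^×`, `λ^{×pf}` of `𝒟†_{≤3}` are distinct.
[cite: MochizukiAbsTopIII2015, Cor 3.7 (iii) p.88] -/
theorem eLamTimes_ne_eLamPf : eLamTimes.{u} ≠ eLamPf.{u} := by
  intro h
  have h' := congrArg ULift.down h
  exact Bool.noConfusion h'

/-- The first-row vertices `⋎ = n` of `𝒟†_{≤3}` are indexed injectively by `n`.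
[cite: MochizukiAbsTopIII2015, Cor 3.7 (iii) p.88] -/
theorem lvFirst_injective {m n : ℤ} (h : lvFirst.{u} m = lvFirst.{u} n) : m = n := by
  simp only [lvFirst, ExtShape.base, dv] at h
  injection h with h
  injection h with h
  injection h

/-- Paths on `Γ⃗_{𝒟†_{≤3}}` starting at the observation vertex `𝒩` are trivial (there are no telecore
edges). [cite: MochizukiAbsTopIII2015, Cor 3.7 (iii) p.88] -/
theorem path_from_lvObs {d : logObsShape.{u}.Vertex} (r : Path lvObs.{u} d) :
    ∃ e : d = lvObs.{u}, e ▸ r = Path.nil := by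
  have hJ : ∀ a, IsEmpty (logObsShape.{u}.J a) := fun _ => inferInstanceAs (IsEmpty PEmpty)
  exact ⟨eq_obs_of_path_from_obs hJ r, path_obs_eq_nil hJ r _⟩

end PathLemmas

/-! ## Cells: the pairs of `E_log` with their prefix -/

/-- A CELL of the boundary set `E_log` (proof of Cor 3.6 (iii) p. 81, read for `𝒟†_{≤3}` of Cor 3.7
with `pr_⋎` for `id_⋎`): type (3) `refl γ e` = the reflexive pair of the path `[e]∘[γ]`
(`e ∈ {λ^×, λ^{×pf}}`, `γ` a path to `□`); type (2) `times γ` = `([λ^×]∘[γ], [λ^{×pf}]∘[γ])`; type (1)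
`log n γ` = `([λ^×]∘[pr_⋎]∘[log_𝒳]∘[γ], [λ^{×pf}]∘[pr_{⋎+1}]∘[γ])` with `⋎ = n`, `γ` a path to `⋎+1`.
All cells end at the observation vertex `𝒩`. [cite: MochizukiAbsTopIII2015, Cor 3.7 (iii) p.88] -/
inductive ObsCell : logObsShape.{u}.Vertex → logObsShape.{u}.Vertex → Type u
  | refl {a : logObsShape.{u}.Vertex} (r : Path a lvBox.{u}) (e : lvBox.{u} ⟶ lvObs.{u}) :
      ObsCell a lvObs.{u}
  | times {a : logObsShape.{u}.Vertex} (r : Path a lvBox.{u}) : ObsCell a lvObs.{u}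
  | log {a : logObsShape.{u}.Vertex} (n : ℤ) (r : Path a (lvFirst.{u} (n + 1))) : ObsCell a lvObs.{u}

namespace ObsCell

/-- The left path `[γ₁]` of a cell. [cite: MochizukiAbsTopIII2015, Cor 3.7 (iii) p.88] -/
def left : ∀ {a b : logObsShape.{u}.Vertex}, ObsCell a b → Path a b
  | _, _, refl r e => r.cons e
  | _, _, times r => r.cons eLamTimes
  | _, _, log n r => ((r.cons (eLog n)).cons (ePr n)).cons eLamTimes

/-- The right path `[γ₂]` of a cell. [cite: MochizukiAbsTopIII2015, Cor 3.7 (iii) p.88] -/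
def right : ∀ {a b : logObsShape.{u}.Vertex}, ObsCell a b → Path a b
  | _, _, refl r e => r.cons e
  | _, _, times r => r.cons eLamPf
  | _, _, log n r => (r.cons (ePr (n + 1))).cons eLamPf

/-- Cells end at `𝒩`. [cite: MochizukiAbsTopIII2015, Cor 3.7 (iii) p.88] -/
theorem eq_obs {a b : logObsShape.{u}.Vertex} (g : ObsCell a b) : b = lvObs.{u} := by
  cases g <;> rfl

/-- Prefixing a cell by a path `[γ]` ("`∘[γ]`" in the text's types (1), (2)).
[cite: MochizukiAbsTopIII2015, Cor 3.7 (iii) p.88] -/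
def precomp {c : logObsShape.{u}.Vertex} :
    ∀ {a b : logObsShape.{u}.Vertex}, Path c a → ObsCell a b → ObsCell c b
  | _, _, r₀, refl r e => refl (r₀.comp r) e
  | _, _, r₀, times r => times (r₀.comp r)
  | _, _, r₀, log n r => log n (r₀.comp r)

/-- [cite: MochizukiAbsTopIII2015, Cor 3.7 (iii) p.88] -/
@[simp] theorem left_precomp {c a b : logObsShape.{u}.Vertex} (r₀ : Path c a) (g : ObsCell a b) :
    (g.precomp r₀).left = r₀.comp g.left := by
  cases g <;> rfl

/-- [cite: MochizukiAbsTopIII2015, Cor 3.7 (iii) p.88] -/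
@[simp] theorem right_precomp {c a b : logObsShape.{u}.Vertex} (r₀ : Path c a) (g : ObsCell a b) :
    (g.precomp r₀).right = r₀.comp g.right := by
  cases g <;> rfl

/-- The reflexive cell on the left path of a cell. [cite: MochizukiAbsTopIII2015, Cor 3.7 (iii) p.88] -/
def reflLeft : ∀ {a b : logObsShape.{u}.Vertex}, ObsCell a b → ObsCell a b
  | _, _, refl r e => refl r e
  | _, _, times r => refl r eLamTimes
  | _, _, log n r => refl ((r.cons (eLog n)).cons (ePr n)) eLamTimes

/-- The reflexive cell on the right path of a cell. [cite: MochizukiAbsTopIII2015, Cor 3.7 (iii) p.88] -/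
def reflRight : ∀ {a b : logObsShape.{u}.Vertex}, ObsCell a b → ObsCell a b
  | _, _, refl r e => refl r e
  | _, _, times r => refl r eLamPf
  | _, _, log n r => refl (r.cons (ePr (n + 1))) eLamPf

/-- [cite: MochizukiAbsTopIII2015, Cor 3.7 (iii) p.88] -/
theorem reflLeft_left {a b : logObsShape.{u}.Vertex} (g : ObsCell a b) : g.reflLeft.left = g.left := by
  cases g <;> rfl

/-- [cite: MochizukiAbsTopIII2015, Cor 3.7 (iii) p.88] -/
theorem reflLeft_right {a b : logObsShape.{u}.Vertex} (g : ObsCell a b) :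
    g.reflLeft.right = g.left := by
  cases g <;> rfl

/-- [cite: MochizukiAbsTopIII2015, Cor 3.7 (iii) p.88] -/
theorem reflRight_left {a b : logObsShape.{u}.Vertex} (g : ObsCell a b) :
    g.reflRight.left = g.right := by
  cases g <;> rfl

/-- [cite: MochizukiAbsTopIII2015, Cor 3.7 (iii) p.88] -/
theorem reflRight_right {a b : logObsShape.{u}.Vertex} (g : ObsCell a b) :
    g.reflRight.right = g.right := by
  cases g <;> rfl

/-- A pair of `E_log` determines its cell: the type is read off the last edges (equal — type (3);
`λ^×` vs `λ^{×pf}` with the same prefix — type (2); otherwise type (1), the prefixes then differing by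
`[pr_⋎]∘[log_𝒳]` vs `[pr_{⋎+1}]`), and the prefix `γ` off the paths.
[cite: MochizukiAbsTopIII2015, Cor 3.7 (iii) p.88] -/
theorem ext' {a b : logObsShape.{u}.Vertex} {g g' : ObsCell a b} (hl : g.left = g'.left)
    (hr : g.right = g'.right) : g = g' := by
  cases g with
  | refl r e =>
    cases g' with
    | refl r' e' =>
      simp only [left] at hl
      cases prefix_eq hl; cases edge_eq hl; rfl
    | times r' =>
      simp only [left, right] at hl hr
      exact absurd ((edge_eq hl).symm.trans (edge_eq hr)) eLamTimes_ne_eLamPf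
    | log n' r' =>
      simp only [left, right] at hl hr
      exact absurd ((edge_eq hl).symm.trans (edge_eq hr)) eLamTimes_ne_eLamPf
  | times r =>
    cases g' with
    | refl r' e' =>
      simp only [left, right] at hl hr
      exact absurd ((edge_eq hl).trans (edge_eq hr).symm) eLamTimes_ne_eLamPf
    | times r' =>
      simp only [left] at hl
      cases prefix_eq hl; rfl
    | log n' r' =>
      simp only [left, right] at hl hr
      have h := (prefix_eq hl).symm.trans (prefix_eq hr)
      have hn := lvFirst_injective (Path.obj_eq_of_cons_eq_cons h)
      omega
  | log n r =>
    cases g' with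
    | refl r' e' =>
      simp only [left, right] at hl hr
      exact absurd ((edge_eq hl).trans (edge_eq hr).symm) eLamTimes_ne_eLamPf
    | times r' =>
      simp only [left, right] at hl hr
      have h := (prefix_eq hl).trans (prefix_eq hr).symm
      have hn := lvFirst_injective (Path.obj_eq_of_cons_eq_cons h)
      omega
    | log n' r' =>
      simp only [left, right] at hl hr
      have h := prefix_eq hr
      have hn : n = n' := by have := lvFirst_injective (Path.obj_eq_of_cons_eq_cons h); omega
      subst hn
      cases prefix_eq h
      rfl

/-- No two non-reflexive cells compose: if the right path of `g` is the left path of `g'`, then `g`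
or `g'` is reflexive (right paths of types (1)/(2) end in `λ^{×pf}`, left paths in `λ^×`).
[cite: MochizukiAbsTopIII2015, Cor 3.7 (iii) p.88] -/
theorem dichotomy {a b : logObsShape.{u}.Vertex} {g g' : ObsCell a b} (e : g.right = g'.left) :
    g.left = g.right ∨ g'.right = g'.left := by
  cases g with
  | refl r f => exact Or.inl rfl
  | times r =>
    cases g' with
    | refl r' f' => exact Or.inr rfl
    | times r' =>
      simp only [left, right] at e; exact absurd (edge_eq e).symm eLamTimes_ne_eLamPf
    | log n' r' =>
      simp only [left, right] at e; exact absurd (edge_eq e).symm eLamTimes_ne_eLamPf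
  | log n r =>
    cases g' with
    | refl r' f' => exact Or.inr rfl
    | times r' =>
      simp only [left, right] at e; exact absurd (edge_eq e).symm eLamTimes_ne_eLamPf
    | log n' r' =>
      simp only [left, right] at e; exact absurd (edge_eq e).symm eLamTimes_ne_eLamPf

end ObsCell

/-! ## The boundary set `E_log` and its saturation -/

/-- **The boundary set `E_log`** of `𝔖†_log`: the ordered pairs of paths on `Γ⃗_{𝒟†_{≤3}}` that are the two
sides of a cell (types (1), (2), (3) of the proof of Cor 3.6 (iii) p. 81, read for Cor 3.7).
[cite: MochizukiAbsTopIII2015, Cor 3.7 (iii) p.88] -/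
inductive ObsRel : ∀ ⦃a b : logObsShape.{u}.Vertex⦄, Path a b → Path a b → Prop
  | mk {a b : logObsShape.{u}.Vertex} (g : ObsCell.{u} a b) : ObsRel g.left g.right

/-- A pair of `E_log` comes from a cell. [cite: MochizukiAbsTopIII2015, Cor 3.7 (iii) p.88] -/
theorem ObsRel.out {a b : logObsShape.{u}.Vertex} {p q : Path a b} (h : ObsRel p q) :
    ∃ g : ObsCell.{u} a b, p = g.left ∧ q = g.right := by
  cases h with
  | mk g => exact ⟨g, rfl, rfl⟩

/-- "One verifies immediately that `E_log` is saturated" (§0 p. 26 (a), (c), (d), (e)).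
[cite: MochizukiAbsTopIII2015, Cor 3.7 (iii) p.88] -/
theorem isSaturated_obsRel : IsSaturated ObsRel.{u} where
  refl_left := by
    rintro a b p q ⟨g⟩
    have h := ObsRel.mk g.reflLeft
    rwa [ObsCell.reflLeft_left, ObsCell.reflLeft_right] at h
  refl_right := by
    rintro a b p q ⟨g⟩
    have h := ObsRel.mk g.reflRight
    rwa [ObsCell.reflRight_left, ObsCell.reflRight_right] at h
  trans := by
    rintro a b p q r ⟨g⟩ h₂
    obtain ⟨g', e, rfl⟩ := h₂.out
    rcases ObsCell.dichotomy e with e' | e'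
    · rw [e', e]; exact ObsRel.mk g'
    · rw [e', ← e]; exact ObsRel.mk g
  precomp := by
    rintro a b c p q ⟨g⟩ r₀
    have h := ObsRel.mk (g.precomp r₀)
    rwa [ObsCell.left_precomp, ObsCell.right_precomp] at h
  postcomp := by
    rintro a b c p q ⟨g⟩ r₂
    obtain rfl := g.eq_obs
    obtain ⟨rfl, hr⟩ := path_from_lvObs r₂
    cases hr
    exact ObsRel.mk g

/-- Behind a prefix `γ`, the basic type-(2) pair lies in the saturation of the generators.
[cite: MochizukiAbsTopIII2015, Cor 3.7 (iii) p.88] -/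
theorem saturation_times {a : logObsShape.{u}.Vertex} (r : Path a lvBox.{u}) :
    Saturation LogGen.{u} (r.cons eLamTimes) (r.cons eLamPf) :=
  Saturation.precomp r (Saturation.base LogGen.type2)

/-- **`E_log` is the saturation of the printed generators** (`LogGen`: the basic pairs of types (1),
(2)): `𝔖†_log` is GENERATED by `ι_{log,⋎}`, `ι_×` in the sense of Def 3.5 (ii).
[cite: MochizukiAbsTopIII2015, Cor 3.7 (iii) p.88] -/
theorem obsRel_iff_saturation {a b : logObsShape.{u}.Vertex} (p q : Path a b) :
    ObsRel p q ↔ Saturation LogGen.{u} p q := by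
  constructor
  · rintro ⟨g⟩
    cases g with
    | refl r e =>
      rcases e with ⟨_ | _⟩
      · exact (saturation_times r).refl_right
      · exact (saturation_times r).refl_left
    | times r => exact saturation_times r
    | log n r => exact Saturation.precomp r (Saturation.base (LogGen.type1 n))
  · intro h
    induction h with
    | base hg =>
      cases hg with
      | type1 n => exact ObsRel.mk (ObsCell.log n Path.nil)
      | type2 => exact ObsRel.mk (ObsCell.times Path.nil)
    | refl_left _ ih => exact isSaturated_obsRel.refl_left ih
    | refl_right _ ih => exact isSaturated_obsRel.refl_right ih
    | trans _ _ ih₁ ih₂ => exact isSaturated_obsRel.trans ih₁ ih₂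
    | precomp r _ ih => exact isSaturated_obsRel.precomp ih r
    | postcomp r _ ih => exact isSaturated_obsRel.postcomp ih r

end BiAnabelianSetting

end Literature.AnabelianGeometry.AbsoluteAnabelian.AbsTopIII
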